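import Mathlib
import Literature.NumberTheory.Automorphic.HilbertModularFormQExpansion

/-!
# Level sets of the total degree on `ℕ^d` are finite of polynomial size

Stub R2 (`stub_totalDegree_levelCount`) of line Sketch-ideate-r1-k1 of the crux
`HilbertIntegralOverconvergentIsCongruence` (stmt-Langlands-8485).  The `d`-free algebraization
engine of the line weighs the exponents `Fin d →₀ ℕ` of `MvPowerSeries (Fin d)` by their total
degree `n ↦ ∑ j, n j`, and its summability lemma needs the level sets `{n | ∑ j, n j = m}` to be
finite with at most `(m + 1) ^ d` elements.

Proof: the coercion `n ↦ ⇑n` (i.e. `Finsupp.equivFunOnFinite`) is injective and maps the level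
set into the box `Fintype.piFinset fun _ : Fin d ↦ Finset.range (m + 1)`, because every
coordinate satisfies `n j ≤ ∑ i, n i = m` (`Finset.single_le_sum`).  The box is a finset of
cardinality `(m + 1) ^ d` (`Fintype.card_piFinset_const`, `Finset.card_range`), so the level set
is finite (`Set.Finite.of_finite_image`) and `Set.ncard_le_ncard_of_injOn` bounds its size.
-/

set_option linter.dupNamespace false

noncomputable section

namespace Summit.Langlands.Langlands.Theorems.HilbertIntegralOverconvergentIsCongruence

/-- Every coordinate of a point of the level set `{n : Fin d →₀ ℕ | ∑ j, n j = m}` is at most `m`,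
so the coercion to functions maps the level set into the box `∏_{j : Fin d} {0, …, m}`. -/
theorem tdl_mapsTo_box (d m : ℕ) :
    ∀ n ∈ {n : Fin d →₀ ℕ | ∑ j, n j = m},
      (Finsupp.equivFunOnFinite n : Fin d → ℕ) ∈
        ((Fintype.piFinset fun _ : Fin d ↦ Finset.range (m + 1) : Finset (Fin d → ℕ)) :
          Set (Fin d → ℕ)) := by
  intro n hn
  simp only [Set.mem_setOf_eq] at hn
  simp only [Finset.mem_coe, Fintype.mem_piFinset, Finset.mem_range]
  intro j
  have hj : n j ≤ ∑ i, n i :=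
    Finset.single_le_sum (fun i _ ↦ Nat.zero_le (n i)) (Finset.mem_univ j)
  rw [hn] at hj
  simpa [Finsupp.equivFunOnFinite] using Nat.lt_succ_of_le hj

/-- The box `∏_{j : Fin d} {0, …, m}` has exactly `(m + 1) ^ d` elements. -/
theorem tdl_card_box (d m : ℕ) :
    (Fintype.piFinset fun _ : Fin d ↦ Finset.range (m + 1)).card = (m + 1) ^ d := by
  rw [Fintype.card_piFinset_const, Finset.card_range]

/-- **Stub R2.** The level sets of the total degree on `ℕ^d` are finite of polynomial size:
`#{n : Fin d →₀ ℕ | ∑ j, n j = m} ≤ (m + 1) ^ d` (every coordinate is at most `m`). -/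
theorem stub_totalDegree_levelCount (d m : ℕ) :
    {n : Fin d →₀ ℕ | ∑ j, n j = m}.Finite ∧ (({n : Fin d →₀ ℕ | ∑ j, n j = m}.ncard : ℕ) : ℝ) ≤ ((m : ℝ) + 1) ^ d := by
  classical
  have hmaps := tdl_mapsTo_box d m
  have hinj : Set.InjOn (Finsupp.equivFunOnFinite : (Fin d →₀ ℕ) ≃ (Fin d → ℕ))
      {n : Fin d →₀ ℕ | ∑ j, n j = m} :=
    Finsupp.equivFunOnFinite.injective.injOn
  have hbox : (((Fintype.piFinset fun _ : Fin d ↦ Finset.range (m + 1) : Finset (Fin d → ℕ)) :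
      Set (Fin d → ℕ))).Finite := Finset.finite_toSet _
  have hfin : {n : Fin d →₀ ℕ | ∑ j, n j = m}.Finite :=
    Set.Finite.of_finite_image (hbox.subset (Set.image_subset_iff.mpr hmaps)) hinj
  refine ⟨hfin, ?_⟩
  have hcard : {n : Fin d →₀ ℕ | ∑ j, n j = m}.ncard ≤
      (Fintype.piFinset fun _ : Fin d ↦ Finset.range (m + 1)).card := by
    rw [← Set.ncard_coe_finset]
    exact Set.ncard_le_ncard_of_injOn _ hmaps hinj hbox
  rw [tdl_card_box] at hcard
  calc (({n : Fin d →₀ ℕ | ∑ j, n j = m}.ncard : ℕ) : ℝ) ≤ (((m + 1) ^ d : ℕ) : ℝ) := by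
        exact_mod_cast hcard
    _ = ((m : ℝ) + 1) ^ d := by push_cast; ring

end Summit.Langlands.Langlands.Theorems.HilbertIntegralOverconvergentIsCongruence
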